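import Mathlib
import HarnessLib
import Summits.MatrixMultiplication.MatrixMultiplication.Theorems.OutsiderSandwichSymmetricCore
import Summits.MatrixMultiplication.MatrixMultiplication.Theorems.FarEdgeDescentSymmetricCoverCore

/-!
# Outsider sandwich — the symmetric core: the level-one rung and the fibre exchange exponent
# (decomp-mm lens-4, g23, part 2)

Lens «minimal-counterexample / extremal reduction», generation 23, supporting item
`stmt-MatrixMultiplication-27147` (`Theses.OutsiderSandwich.BlockOneIsMM`; cut of record UNCHANGED).

Part 1 (`OutsiderSandwichSymmetricCore`) proved the FLOOR of the symmetric core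
`P = (S; u, w) ↦ (Su, Sw)`: `SymHelped N B → 4^N ≤ B · 3^N`, fibre rate `≥ log₂(4/3) > 2/5 > θ⋆`.
This file supplies the matching RUNG and the extremal number:

* **`symCore_apply`**: the closed form `P p (k,j) (k',l) = [k ≠ k'] · [j + l = p]`;
* **`ζ⁽¹⁾(P) = 3` exactly** (`flatteningRank_symCore`): the floor's point value is attained;
* **the level-one rung `SymHelped 1 2`** (`symHelped_one_two`): `⟨2⟩ ⊠ P ≥ ⟨2,2,2⟩` by the explicit
  split `A = A_s + t·J` (`A_s` the symmetric part, fed to copy `0`; `t = (A₀₁ − A₁₀)/2`,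
  `J = [[0,1],[-1,0]]`; copy `1` is fed `S = t·I` with its vector inputs twisted by `J`): at level one
  the core ALREADY suffices (`r_P(1) = r(1) = 2`) — the antisymmetric letter is needed only in the limit;
* hence `SymHelped N (2^N)`, `SymExponentAchieved 1`, and the **fibre exchange exponent**
  `θ_P := inf {θ | SymExponentAchieved θ}` (`symExchangeExponent`) is well defined with
  **`log₂(4/3) ≤ θ_P ≤ 1`** and **`θ⋆ < θ_P`** (`exchangeExponent_lt_symExchangeExponent`): the coupled
  block is a STRICTLY better helper than its symmetric core, by more than `0.042` in rate.

All statements are explicit restrictions with `0, ±1, ±1/2` matrices; no `sorry`, no new axioms.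
-/

noncomputable section

open Literature.Computability.AlgebraicComplexity
open Summit.MatrixMultiplication.MatrixMultiplication.Theorems.OutsiderSandwichBlockNormalForm (pairTensor)
open Summit.MatrixMultiplication.MatrixMultiplication.Theorems.OutsiderSandwichGluingGain
  (uHalf directSumTensor_restrictsTo_add')
open Summit.MatrixMultiplication.MatrixMultiplication.Theorems.OutsiderSandwichTraceDefect
  (mmPair wPlain mmPair_two_restrictsTo_matMul)
open Summit.MatrixMultiplication.MatrixMultiplication.Theorems.OutsiderSandwichExchangeExponent
  (exchangeExponent)
open Summit.MatrixMultiplication.MatrixMultiplication.Theorems.FarEdgeDescentSymmetricCover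
  (unitTwo_kronecker_restrictsTo_directSum_self)
open Summit.MatrixMultiplication.MatrixMultiplication.Theorems.OutsiderSandwichSymmetricCore

namespace Summit.MatrixMultiplication.MatrixMultiplication.Theorems.OutsiderSandwichSymmetricCoreRung

/-! ## 0. Tools: matrices on the first legs -/

section Tools

variable {K : Type} [CommSemiring K] {ι κ μ ι' κ' : Type} [Fintype ι] [Fintype κ] [Fintype μ]
  [DecidableEq κ] [DecidableEq μ]

/-- **An arbitrary matrix on the first leg (identities on the others) gives a restriction.**
[cite: Blaser2013, Def. 7.2] -/
theorem tensorRestrictsTo_linear₁ (t : ι → κ → μ → K) (A : ι' → ι → K) :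
    TensorRestrictsTo t (fun a' b c => ∑ a, A a' a * t a b c) := by
  refine ⟨A, fun b' b => if b' = b then 1 else 0, fun c' c => if c' = c then 1 else 0,
    fun a' b' c' => ?_⟩
  refine Finset.sum_congr rfl fun a _ => ?_
  rw [Finset.sum_eq_single b' (fun b _ hb => by simp [Ne.symm hb]) (by simp),
    Finset.sum_eq_single c' (fun c _ hc => by simp [Ne.symm hc]) (by simp)]
  simp

omit [DecidableEq κ] in
/-- **Arbitrary matrices on the first two legs (identity on the third) give a restriction.**
[cite: Blaser2013, Def. 7.2] -/
theorem tensorRestrictsTo_linear₁₂ (t : ι → κ → μ → K) (A : ι' → ι → K) (B : κ' → κ → K) :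
    TensorRestrictsTo t (fun a' b' c => ∑ a, ∑ b, A a' a * B b' b * t a b c) := by
  refine ⟨A, B, fun c' c => if c' = c then 1 else 0, fun a' b' c' => ?_⟩
  refine Finset.sum_congr rfl fun a _ => Finset.sum_congr rfl fun b _ => ?_
  rw [Finset.sum_eq_single c' (fun c _ hc => by simp [Ne.symm hc]) (by simp)]
  simp

end Tools

/-! ## 1. The closed form of the core and `ζ⁽¹⁾(P) = 3` -/

/-- **Closed form**: `P p y z = 1` iff the input and output blocks differ (the `u ↦ Su` or the
`w ↦ Sw` half) and the matrix position `(y.2, z.2)` has weight `p = y.2 + z.2`; else `0`. [folklore] -/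
theorem symCore_apply (p : Fin 3) (y z : Fin 2 × Fin 2) :
    symCore p y z = if y.1 ≠ z.1 ∧ y.2.val + z.2.val = p.val then 1 else 0 := by
  obtain ⟨y₁, y₂⟩ := y
  obtain ⟨z₁, z₂⟩ := z
  simp only [symCore, Fintype.sum_prod_type, Fin.sum_univ_two, pairTensor, symWt]
  fin_cases p <;> fin_cases y₁ <;> fin_cases y₂ <;> fin_cases z₁ <;> fin_cases z₂ <;> simp

/-- The three slices of `P` are linearly independent: **`ζ⁽¹⁾(P) = 3`** (evaluate a relation at the
input `u_j`, output `(Su)_l`, `j + l = p`). [cite: ChristandlVranaZuiddam2023, Example 1.4] -/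
theorem flatteningRank_symCore : flatteningRank symCore = 3 := by
  have key : ∀ q : Fin 3, ∃ yz : (Fin 2 × Fin 2) × (Fin 2 × Fin 2),
      ∀ q' : Fin 3, symCore q' yz.1 yz.2 = if q' = q then 1 else 0 := by
    intro q
    fin_cases q
    · exact ⟨(((0 : Fin 2), (0 : Fin 2)), ((1 : Fin 2), (0 : Fin 2))), fun q' => by
        rw [symCore_apply]; fin_cases q' <;> simp⟩
    · exact ⟨(((0 : Fin 2), (0 : Fin 2)), ((1 : Fin 2), (1 : Fin 2))), fun q' => by
        rw [symCore_apply]; fin_cases q' <;> simp⟩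
    · exact ⟨(((0 : Fin 2), (1 : Fin 2)), ((1 : Fin 2), (1 : Fin 2))), fun q' => by
        rw [symCore_apply]; fin_cases q' <;> simp⟩
  have hli : LinearIndependent ℂ (xSlices symCore) := by
    rw [Fintype.linearIndependent_iff]
    intro g hg p
    obtain ⟨yz, hyz⟩ := key p
    have h := congrFun hg yz
    rw [Finset.sum_apply, Pi.zero_apply] at h
    simp only [Pi.smul_apply, xSlices_apply, smul_eq_mul, hyz, mul_ite, mul_one, mul_zero,
      Finset.sum_ite_eq', Finset.mem_univ, if_true] at h
    exact h
  unfold flatteningRank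
  rw [finrank_span_eq_card hli, Fintype.card_fin]

/-- `ζ⁽¹⁾(P) = 3` at the level of the tree's gauge point. [cite: ChristandlVranaZuiddam2023, Example 1.4] -/
theorem gaugePoint₁_symCore : gaugePoint₁ ℂ symCore = 3 := by
  rw [gaugePoint₁_eq, flatteningRank_symCore]
  norm_num

/-! ## 2. The level-one rung: `⟨2⟩ ⊠ P ≥ ⟨2,2,2⟩` by `A = A_s + t·J` -/

/-- Copy `0` is fed the SYMMETRIC PART `A_s`: `s_p = ∑_{r+c=p} A_{rc} / #\{r+c=p\}`
(`s₀ = A₀₀`, `s₁ = (A₀₁+A₁₀)/2`, `s₂ = A₁₁`). [folklore] -/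
def symM (a : Fin 2 × Fin 2) (p : Fin 3) : ℂ :=
  if a.1.val + a.2.val = p.val then (if a.1 = a.2 then 1 else 1 / 2) else 0

/-- Copy `1` is fed the SCALAR matrix `t·I`, `t = (A₀₁ − A₁₀)/2` (`s₀ = s₂ = t`, `s₁ = 0`). [folklore] -/
def skewM (a : Fin 2 × Fin 2) (p : Fin 3) : ℂ :=
  if p.val = 1 then 0
  else if a.1 = 0 ∧ a.2 = 1 then 1 / 2 else if a.1 = 1 ∧ a.2 = 0 then -(1 / 2) else 0

/-- The input twist of copy `1`: both vector arguments through `J = [[0,1],[-1,0]]`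
(`(Jv)₀ = v₁`, `(Jv)₁ = −v₀`); matrix entry `(target y', source y)`. [folklore] -/
def twistJ (y' y : Fin 2 × Fin 2) : ℂ :=
  if y.1 = y'.1 then (if y.2 = 0 ∧ y'.2 = 1 then 1 else if y.2 = 1 ∧ y'.2 = 0 then -1 else 0) else 0

/-- The symmetric-part slot `(A; u, w) ↦ (A_s u, A_s w)` as a restriction image of `P`. [folklore] -/
def symPart : Fin 2 × Fin 2 → Fin 2 × Fin 2 → Fin 2 × Fin 2 → ℂ :=
  fun a' y z => ∑ p, symM a' p * symCore p y z

/-- The skew slot `(A; u, w) ↦ (t·Ju, t·Jw) = (A_a u, A_a w)` (`A_a = t·J` the antisymmetric part)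
as a restriction image of `P`. [folklore] -/
def skewPart : Fin 2 × Fin 2 → Fin 2 × Fin 2 → Fin 2 × Fin 2 → ℂ :=
  fun a' y' z => ∑ p, ∑ y, skewM a' p * twistJ y' y * symCore p y z

/-- `P ≥ symPart`. [cite: Blaser2013, Def. 7.2] -/
theorem symCore_restrictsTo_symPart : TensorRestrictsTo symCore symPart :=
  tensorRestrictsTo_linear₁ symCore symM

/-- `P ≥ skewPart`. [cite: Blaser2013, Def. 7.2] -/
theorem symCore_restrictsTo_skewPart : TensorRestrictsTo symCore skewPart :=
  tensorRestrictsTo_linear₁₂ symCore skewM twistJ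

/-- **`A = A_s + t·J` as a tensor identity**: `symPart + skewPart = mmPair 2 ≅ ⟨2,2,2⟩`
(`64` entries, checked by cases). [folklore] -/
theorem symPart_add_skewPart : symPart + skewPart = mmPair 2 := by
  funext a y z
  obtain ⟨a₁, a₂⟩ := a
  obtain ⟨y₁, y₂⟩ := y
  obtain ⟨z₁, z₂⟩ := z
  simp only [Pi.add_apply, symPart, skewPart, symM, skewM, twistJ, symCore_apply, mmPair, uHalf,
    wPlain, Fin.sum_univ_three, Fintype.sum_prod_type, Fin.sum_univ_two]
  fin_cases a₁ <;> fin_cases a₂ <;> fin_cases y₁ <;> fin_cases y₂ <;> fin_cases z₁ <;>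
    fin_cases z₂ <;> norm_num

/-- **`⟨2⟩ ⊠ P ≥ mmPair 2`**: two copies of the core compute both products `Au, Aw`.
[cite: Blaser2013, §5 (the tensor ⟨k,m,n⟩)] -/
theorem unitTwo_symCore_restrictsTo_mmPair :
    TensorRestrictsTo (kroneckerTensor (unitTensor ℂ 2) symCore) (mmPair 2) := by
  rw [← symPart_add_skewPart]
  exact ((unitTwo_kronecker_restrictsTo_directSum_self symCore).trans
    (symCore_restrictsTo_symPart.directSum symCore_restrictsTo_skewPart)).trans
    (directSumTensor_restrictsTo_add' _ _)

/-! ## 3. Exchange algebra for the core and the rung `SymHelped 1 2` -/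

/-- `SymHelped N B ⟺ [⟨2,2,2⟩]^N ≤ B · [P]^N` in `T(ℂ)`. [cite: Zuiddam2018, §2.3] -/
theorem symHelped_iff_le (N B : ℕ) :
    SymHelped N B ↔ TensorClass.mk (matMulTensor ℂ 2 2 2) ^ N ≤
      (B : TensorClass ℂ) * TensorClass.mk symCore ^ N := by
  unfold SymHelped HelpedBy
  rw [TensorClass.mk_pow, TensorClass.mk_pow, TensorClass.natCast_eq_mk, TensorClass.mk_mul_mk,
    TensorClass.mk_le_mk_iff]

/-- Core help counts multiply: `SymHelped M B → SymHelped N B' → SymHelped (M+N) (B B')`. [folklore] -/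
theorem symHelped_mul {M N B B' : ℕ} (h : SymHelped M B) (h' : SymHelped N B') :
    SymHelped (M + N) (B * B') := by
  rw [symHelped_iff_le] at h h' ⊢
  calc TensorClass.mk (matMulTensor ℂ 2 2 2) ^ (M + N)
        = TensorClass.mk (matMulTensor ℂ 2 2 2) ^ M * TensorClass.mk (matMulTensor ℂ 2 2 2) ^ N :=
          pow_add _ _ _
    _ ≤ ((B : TensorClass ℂ) * TensorClass.mk symCore ^ M) *
          ((B' : TensorClass ℂ) * TensorClass.mk symCore ^ N) := TensorClass.mul_le_mul h h'
    _ = ((B * B' : ℕ) : TensorClass ℂ) * TensorClass.mk symCore ^ (M + N) := by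
          push_cast; ring

/-- `SymHelped 0 1`. [folklore] -/
theorem symHelped_zero_one : SymHelped 0 1 := by
  rw [symHelped_iff_le, pow_zero, pow_zero, Nat.cast_one, mul_one]

/-- Powers: `SymHelped N B → SymHelped (k N) (B^k)`. [folklore] -/
theorem symHelped_pow {N B : ℕ} (h : SymHelped N B) (k : ℕ) : SymHelped (k * N) (B ^ k) := by
  induction k with
  | zero => simpa using symHelped_zero_one
  | succ k ih =>
    have e₁ : (k + 1) * N = k * N + N := by ring
    rw [e₁, pow_succ]
    exact symHelped_mul ih h

/-- **The level-one rung `SymHelped 1 2`**: `⟨2⟩ ⊠ P ≥ ⟨2,2,2⟩` — at level one the symmetric core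
already matches the block (`r_P(1) = r(1) = 2`). [cite: Blaser2013, §5 (the tensor ⟨k,m,n⟩)] -/
theorem symHelped_one_two : SymHelped 1 2 := by
  rw [symHelped_iff_le, pow_one, pow_one, TensorClass.natCast_eq_mk, TensorClass.mk_mul_mk,
    TensorClass.mk_le_mk_iff]
  exact unitTwo_symCore_restrictsTo_mmPair.trans mmPair_two_restrictsTo_matMul

/-- **`r_P(1) = 2` exactly**: one copy of the core does not help, two do. [cite: Blaser2013, Thm. 6.3] -/
theorem symExchangeRate_one : ¬ SymHelped 1 1 ∧ SymHelped 1 2 :=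
  ⟨not_symHelped_table.1, symHelped_one_two⟩

/-- `SymHelped N (2^N)` for every `N`. [folklore] -/
theorem symHelped_pow_two_pow (N : ℕ) : SymHelped N (2 ^ N) := by
  simpa using symHelped_pow symHelped_one_two N

/-- The core achieves rate `1`. [folklore] -/
theorem symExponentAchieved_one : SymExponentAchieved 1 := by
  intro N₀
  refine ⟨N₀, le_rfl, 2 ^ N₀, symHelped_pow_two_pow N₀, le_of_eq ?_⟩
  rw [one_mul, Real.rpow_natCast]
  push_cast
  rfl

/-! ## 4. The fibre exchange exponent `θ_P` -/

/-- **`θ_P := inf {θ | SymExponentAchieved θ}`** — the exchange exponent of the symmetric core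
against `⟨2,2,2⟩`. [cite: Strassen1988, Thm. 3.8] -/
def symExchangeExponent : ℝ :=
  sInf {θ : ℝ | SymExponentAchieved θ}

/-- The set of core rates is non-empty. [folklore] -/
theorem symAchieved_nonempty : ({θ : ℝ | SymExponentAchieved θ}).Nonempty :=
  ⟨1, symExponentAchieved_one⟩

/-- The set of core rates is bounded below by `log₂(4/3)`. [cite: ChristandlVranaZuiddam2023, Example 1.4] -/
theorem symAchieved_bddBelow : BddBelow {θ : ℝ | SymExponentAchieved θ} :=
  ⟨Real.logb 2 (4 / 3), fun _ h => logb_le_of_symExponentAchieved h⟩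

/-- **`log₂(4/3) ≤ θ_P`** (the floor). [cite: ChristandlVranaZuiddam2023, Example 1.4] -/
theorem logb_le_symExchangeExponent : Real.logb 2 (4 / 3) ≤ symExchangeExponent :=
  le_csInf symAchieved_nonempty fun _ h => logb_le_of_symExponentAchieved h

/-- **`θ_P ≤ 1`** (the rung). [folklore] -/
theorem symExchangeExponent_le_one : symExchangeExponent ≤ 1 :=
  csInf_le symAchieved_bddBelow symExponentAchieved_one

/-- `θ_P ∈ [log₂(4/3), 1]`. [cite: ChristandlVranaZuiddam2023, Example 1.4] -/
theorem symExchangeExponent_mem_Icc :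
    symExchangeExponent ∈ Set.Icc (Real.logb 2 (4 / 3)) 1 :=
  ⟨logb_le_symExchangeExponent, symExchangeExponent_le_one⟩

/-- **`θ⋆ < θ_P`**: the coupled block is a strictly better helper for `⟨2,2,2⟩` than its symmetric core
(`θ⋆ ≤ 0.37295 < 2/5 < log₂(4/3) ≤ θ_P`); the margin lives in the antisymmetric letter.
[cite: LeGall2014, Table 2] -/
theorem exchangeExponent_lt_symExchangeExponent : exchangeExponent < symExchangeExponent :=
  (exchangeExponent_lt_two_fifths.trans two_fifths_lt_logb).trans_le logb_le_symExchangeExponent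

/-- Numerically: `θ_P − θ⋆ > 2/5 − 0.37295 > 0.027` and indeed `> log₂(4/3) − 0.37295`; here the
rational form `θ⋆ + 27/1000 < θ_P`. [cite: LeGall2014, Table 2] -/
theorem exchangeExponent_add_lt_symExchangeExponent :
    exchangeExponent + 27 / 1000 < symExchangeExponent := by
  have h₁ := OutsiderSandwichExchangeExponent.exchangeExponent_le_leGall
  have h₂ := two_fifths_lt_logb.trans_le logb_le_symExchangeExponent
  linarith

end Summit.MatrixMultiplication.MatrixMultiplication.Theorems.OutsiderSandwichSymmetricCoreRung

end
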